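import Literature.AlgebraicGeometry.Smoothening.WeakNeronModel
import Mathlib.RingTheory.Smooth.Locus
import HarnessLib

/-!
# The weak Néron model as a finite family of smooth affine charts (BLR 3.5; Artin (3.6))

Topic: `Literature/AlgebraicGeometry/Smoothening` (Bosch–Lütkebohmert–Raynaud, *Néron Models*,
§3.5: a weak Néron model is a *smooth* `R`-model of finite type (here: a finite family of smooth
affine charts) through which all `R'`-valued points factor; M. Artin, *Néron Models*, Lemma (3.6)
and the first lines of the proof of (3.2): "replacing `V` by an open subset if necessary, we may
assume `V` smooth"). From the smoothenings of the charts of a projective model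
(`WeakNeronModel`) we pass to the **smooth loci**: the smooth locus of a chart `Spec A_{s,i}` is
open (Mathlib `Algebra.isOpen_smoothLocus`), hence a finite union of basic opens `D(f)` with
`A_{s,i}[1/f]` smooth over `R` (Mathlib `Algebra.basicOpen_subset_smoothLocus_iff_smooth`), and
every test point lifted to a point of `Spec A_{s,i}` at which `δ = 0` — a smooth point
(`ProjectiveModel.isSmoothAt_of_neronDefectOfHom_eq_zero`) — extends to the open chart `D(f)`
containing it, presented in `R[T, U]` as one more step of the affine forest
(`ForestPath.openChart`). Result: `SmoothCharts` (finitely many paths from the model chart to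
charts `R[T]/J` which are *smooth* `R`-algebras, lifting all test points),
`ProjectiveModel.nonempty_smoothCharts`, and the weak Néron property in this form,
`ProjectiveModel.exists_smoothChart_lift_of_point`. [folklore]; no named facts (D-0026).

## References

* S. Bosch, W. Lütkebohmert, M. Raynaud, *Néron Models*, Springer 1990, §3.5 Def. 1 and the
  existence of weak Néron models. [BLRNeronModels1990] (Not held; numbers only.)
* M. Artin, *Néron Models*, in Cornell–Silverman (eds.), *Arithmetic Geometry*, Springer 1986,
  Lemma (3.6) (p. 225), proof of (3.2) (p. 224). [Artin1986NeronModels]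
-/

noncomputable section

open CategoryTheory AlgebraicGeometry IsLocalRing MvPolynomial
open Literature.AlgebraicGeometry.Motives

namespace Literature.AlgebraicGeometry.Smoothening

universe u

/-! ### Smooth charts -/

/-- **A finite family of smooth affine charts capturing the test points of `Spec R[T]/I`**: paths
of the affine forest from the chart to charts `R[T']/J` which are smooth `R`-algebras, such that
every test point (values in a discrete valuation `R`-algebra in which `ϖ` is a uniformizer) lifts
along the structure map of one of them. [folklore] -/
structure SmoothCharts (R : Type u) [CommRing R] (ϖ : R) {N : ℕ} (I : Ideal (MvPolynomial (Fin N) R)) :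
    Type (u + 1) where
  /-- the index set of the charts -/
  ι : Type u
  /-- there are finitely many charts -/
  [fintype : Fintype ι]
  /-- the numbers of variables of the charts -/
  N' : ι → ℕ
  /-- the ideals of the charts -/
  I' : ∀ j, Ideal (MvPolynomial (Fin (N' j)) R)
  /-- the paths to the charts -/
  path : ∀ j, ForestPath R ϖ I (I' j)
  /-- the charts are smooth over `R` -/
  smooth : ∀ j, Algebra.Smooth R (MvPolynomial (Fin (N' j)) R ⧸ I' j)
  /-- every test point lifts to a point of some chart -/
  lift : ∀ (S : Type u) [CommRing S] [IsDomain S] [IsDiscreteValuationRing S] [Algebra R S],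
    Irreducible (algebraMap R S ϖ) →
      ∀ a : (MvPolynomial (Fin N) R ⧸ I) →ₐ[R] S,
        ∃ (j : ι) (b : (MvPolynomial (Fin (N' j)) R ⧸ I' j) →ₐ[R] S), ∀ x, b ((path j).map x) = a x

attribute [instance] SmoothCharts.fintype

/-! ### The smooth locus of a chart is a finite union of smooth basic opens -/

section SmoothLocus

variable (R : Type u) [CommRing R] [IsNoetherianRing R] (A : Type u) [CommRing A] [Algebra R A]
  [Algebra.FiniteType R A]

/-- **The smooth locus of a finitely generated algebra over a Noetherian ring is a finite union of
basic opens `D(f)` with `A[1/f]` smooth.** [folklore] -/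
theorem exists_finset_smoothLocus_eq :
    ∃ t : Finset A, Algebra.smoothLocus R A = ⋃ f ∈ t, (PrimeSpectrum.basicOpen f : Set (PrimeSpectrum A)) ∧
      ∀ f ∈ t, Algebra.Smooth R (Localization.Away f) := by
  classical
  haveI : Algebra.FinitePresentation R A := (Algebra.FinitePresentation.of_finiteType).mp ‹_›
  haveI : IsNoetherianRing A := Algebra.FiniteType.isNoetherianRing R A
  obtain ⟨s, hs⟩ := (PrimeSpectrum.isOpen_iff _).mp (Algebra.isOpen_smoothLocus (R := R) (A := A))
  obtain ⟨t, ht⟩ := (inferInstance : IsNoetherianRing A).noetherian (Ideal.span s)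
  have hU : Algebra.smoothLocus R A = ⋃ f ∈ t, (PrimeSpectrum.basicOpen f : Set (PrimeSpectrum A)) := by
    have h1 : (Algebra.smoothLocus R A)ᶜ = PrimeSpectrum.zeroLocus (t : Set A) := by
      rw [hs, ← PrimeSpectrum.zeroLocus_span s, ← ht, PrimeSpectrum.zeroLocus_span]
    rw [← compl_compl (Algebra.smoothLocus R A), h1]
    ext p
    simp only [Set.mem_compl_iff, PrimeSpectrum.mem_zeroLocus, Set.not_subset, Set.mem_iUnion,
      SetLike.mem_coe, PrimeSpectrum.mem_basicOpen, exists_prop]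
  refine ⟨t, hU, fun f hf => ?_⟩
  refine Algebra.basicOpen_subset_smoothLocus_iff_smooth.mp ?_
  rw [hU]
  exact Set.subset_biUnion_of_mem (u := fun f => (PrimeSpectrum.basicOpen f : Set (PrimeSpectrum A))) hf

end SmoothLocus

/-! ### Smooth charts of a projective model -/

namespace ProjectiveModel

variable {R K : Type u} [CommRing R] [IsDomain R] [IsDiscreteValuationRing R] [Field K] [Algebra R K]
  [IsFractionRing R K] {E : SchemeOver K} (M : ProjectiveModel R K E) {ϖ : R} (hϖ : Irreducible ϖ)

omit [IsDomain R] [IsDiscreteValuationRing R] in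
/-- The open chart `D(F)` of a forest chart `R[T]/I'` is a smooth `R`-algebra when `(R[T]/I')[1/F̄]`
is (`OpenChart.chartEquiv'`). [folklore] -/
theorem smooth_openChart {N' : ℕ} (I' : Ideal (MvPolynomial (Fin N') R)) (F : MvPolynomial (Fin N') R)
    (h : Algebra.Smooth R (Localization.Away (Ideal.Quotient.mk I' F))) :
    Algebra.Smooth R (MvPolynomial (Fin (N' + 1)) R ⧸ Smoothening.chartIdeal I' F) :=
  Algebra.Smooth.of_equiv ((chartEquiv' I' F).restrictScalars R)

include hϖ in
/-- **Smooth charts of a projective model** of a smooth integral `K`-scheme over a discrete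
valuation ring with perfect residue field: the smooth loci of the charts of the smoothenings,
covered by smooth basic opens, capture all test points (Artin (3.6) with "we may assume `V`
smooth"). [cite: Artin1986NeronModels, Lemma (3.6) (p. 225) and proof of (3.2) (p. 224)] -/
theorem nonempty_smoothCharts [PerfectField (ResidueField R)] [IsIntegral E.left] [Smooth E.hom]
    (s : Fin (M.n + 1)) : Nonempty (SmoothCharts R ϖ (M.chartIdeal s)) := by
  classical
  obtain ⟨𝒯⟩ := M.nonempty_smoothening_chart hϖ s
  -- the smooth loci of the forest charts, as finite unions of smooth basic opens
  have hloc := fun i : 𝒯.ι => exists_finset_smoothLocus_eq R (forestRing M s (𝒯.path i))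
  choose t ht hsmooth using hloc
  -- polynomial representatives of the `f ∈ t i`
  refine ⟨{ ι := Σ i : 𝒯.ι, (t i : Set (forestRing M s (𝒯.path i)))
            N' := fun j => 𝒯.N' j.1 + 1
            I' := fun j => Smoothening.chartIdeal (𝒯.I' j.1) (Quotient.out (j.2 : forestRing M s (𝒯.path j.1)))
            path := fun j => (𝒯.path j.1).openChart _
            smooth := fun j => ?_
            lift := fun S _ _ _ _ hπ a => ?_ }⟩
  · -- smoothness of the basic open `D(f)`
    refine smooth_openChart _ _ ?_
    rw [Ideal.Quotient.mk_out]
    exact hsmooth j.1 _ (Finset.mem_coe.mp j.2.2)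
  · -- lifting: first to a `δ = 0` point of a forest chart, a smooth point, then to the `D(f)` containing it
    obtain ⟨i, a', ha', hδ⟩ := 𝒯.lift S hπ a fun z hz => by
      rw [Ideal.mem_bot.mp hz, map_zero, map_zero]; exact zero_mem _
    have hsm : Algebra.IsSmoothAt R ((maximalIdeal S).comap a'.toRingHom) :=
      M.isSmoothAt_of_neronDefectOfHom_eq_zero hϖ s (𝒯.path i) hπ a' hδ
    haveI : ((maximalIdeal S).comap a'.toRingHom).IsPrime := Ideal.comap_isPrime _ _
    have hmem : (⟨(maximalIdeal S).comap a'.toRingHom, inferInstance⟩ : PrimeSpectrum (forestRing M s (𝒯.path i))) ∈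
        Algebra.smoothLocus R (forestRing M s (𝒯.path i)) := hsm
    rw [ht i, Set.mem_iUnion₂] at hmem
    obtain ⟨f, hf, hfmem⟩ := hmem
    rw [SetLike.mem_coe, PrimeSpectrum.mem_basicOpen] at hfmem
    -- `a'(f)` is a unit
    have hunit : IsUnit (a' f) := by
      by_contra hu
      exact hfmem ((IsLocalRing.mem_maximalIdeal _).mpr (mem_nonunits_iff.mpr hu))
    have hunit' : IsUnit (a' (Ideal.Quotient.mk (𝒯.I' i) (Quotient.out f))) := by
      rwa [Ideal.Quotient.mk_out]
    refine ⟨⟨i, f, Finset.mem_coe.mpr hf⟩, chartPoint (𝒯.I' i) (Quotient.out f) a' hunit', fun x => ?_⟩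
    have h1 := chartPoint_algebraMap (𝒯.I' i) (Quotient.out f) a' hunit' ((𝒯.path i).map x)
    change chartPoint (𝒯.I' i) (Quotient.out f) a' hunit'
      (algebraMap _ _ (((𝒯.path i).map : M.chartRing s → _) x)) = a x
    rw [h1]
    exact ha' x

omit [IsDomain R] [IsDiscreteValuationRing R] [IsFractionRing R K] in
/-- **The weak Néron property in smooth charts** (BLR 3.5; Artin, Lemma (3.6)): given smooth
charts `𝒞 s` of the charts of a projective model of `E`, every `L`-valued point of `E` over `K`
(`L = Frac S`, `S` a discrete valuation ring over `R` in which `ϖ` is a uniformizer) is the generic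
point of an `S`-valued point of one of the finitely many smooth affine `R`-schemes
`Spec (R[T]/J_{s,j})` of the `𝒞 s`, mapping to the model through a path of open immersions and
dilatations. [cite: Artin1986NeronModels, Lemma (3.6) (p. 225)] -/
theorem exists_smoothChart_lift_of_point [IsIntegral E.left] [Smooth E.hom]
    (𝒞 : ∀ s : Fin (M.n + 1), SmoothCharts R ϖ (M.chartIdeal s))
    {S L : Type u} [CommRing S] [IsDomain S] [IsDiscreteValuationRing S] [Field L] [Algebra S L]
    [IsFractionRing S L] [Algebra R S] [Algebra K L] [Algebra R L] [IsScalarTower R S L]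
    [IsScalarTower R K L] (hπ : Irreducible (algebraMap R S ϖ))
    (x : Spec (.of L) ⟶ E.left) (hx : x ≫ E.hom = Spec.map (CommRingCat.ofHom (algebraMap K L))) :
    ∃ (s : Fin (M.n + 1)) (j : (𝒞 s).ι)
      (b : (MvPolynomial (Fin ((𝒞 s).N' j)) R ⧸ (𝒞 s).I' j) →ₐ[R] S),
      Spec.map (CommRingCat.ofHom (algebraMap S L)) ≫
          Spec.map (CommRingCat.ofHom (b.comp ((𝒞 s).path j).map).toRingHom) ≫ M.chart s =
            x ≫ M.gen := by
  obtain ⟨s, a, ha⟩ := M.exists_algHom_of_point (O := S) x hx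
  obtain ⟨j, b, hb⟩ := (𝒞 s).lift S hπ a
  have hcomp : b.comp ((𝒞 s).path j).map = a := AlgHom.ext hb
  exact ⟨s, j, b, by rw [hcomp]; exact ha⟩

end ProjectiveModel

end Literature.AlgebraicGeometry.Smoothening

end
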